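import Mathlib
import Summits.Ventures.PercRepro2.HCov
import Summits.Ventures.PercRepro2.Graph
import Summits.Ventures.PercRepro2.RestrictClosure
import Summits.Ventures.PercRepro2.RECMReduction
import Summits.Ventures.PercRepro2.GcSkelRules
import Summits.Ventures.PercRepro2.GcSkelReduction
import Summits.Ventures.PercRepro2.GcSkelReductionI
import Summits.Ventures.PercRepro2.GcSkelWhitney
import Summits.Ventures.PercRepro2.GcSkelWhitneyMain
import Summits.Ventures.PercRepro2.GcBlockConn
import Summits.Ventures.PercRepro2.GcBlock
import Summits.Ventures.PercRepro2.GcSkelReductionT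

/-!
# The block clause as a finite check: unmarked vertices reach the marks past any two vertices
(blind cell PercRepro2, typer-1 g54)

The clause `¬ Block.HasBlock` of the residual `WReducedT` (`GcSkelReductionT.lean`) quantifies
over every vertex set `W`. On `WReducedI` it is equivalent to a finite check:

* **`MarksReach ends o a₁ a₂ a₃ b`** — for every two vertices `u, v`, every unmarked vertex `y ∉
  {u, v}` of positive non-loop degree is connected to one of the five marks in `G − {u, v}`
  (`sepConfig ends {u, v}`, every edge not touching `{u, v}` open);
* **`marksReach_of_wredT`** — on the residual the check holds: the component of `y` in `G − {u, v}`
  is a two-terminal block (`cluster_isBlock`), mark-free if it reached no mark, and touched by the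
  `≥ 3` non-loop edges at `y` — a collapsible block;
* **`not_hasBlock_of_marksReach`** — conversely a collapsible block `W` with terminals `u, v` has a
  vertex `y` of positive non-loop degree, whose component in `G − {u, v}` lies inside `W`
  (`mem_of_conn_sepConfig_of_isBlock`): the mark it reaches would be in `W`;
* **`wredT_iff`** (`WReducedT ↔ WReducedI ∧ MarksReach`) and, with g53's `wredI_iff_wredW`,
  **`wredT_iff_wredW_and_marksReach`**: membership in the residual with no collapsible block is a
  list of finite checks — the unmarked vertices are «3-connected to the marks».
-/

namespace Summit.Ventures.PercRepro2

open CovForm RECM SepPair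

namespace WRed

/-! ## The finite check -/

section Def

variable {V : Type*} {E : Type*} [Fintype E] [DecidableEq E] [DecidableEq V]

/-- **Unmarked vertices reach the marks past any two vertices**: for every `u, v`, every unmarked
`y ∉ {u, v}` of positive non-loop degree is connected to a mark in `G − {u, v}`. -/
def MarksReach (ends : E → Sym2 V) (o a₁ a₂ a₃ b : V) : Prop :=
  ∀ u v y, Unmarked o a₁ a₂ a₃ b y → nonLoopDeg ends y ≠ 0 → y ≠ u → y ≠ v →
    ∃ m, (m = o ∨ m = a₁ ∨ m = a₂ ∨ m = a₃ ∨ m = b) ∧ Conn ends (sepConfig ends {u, v}) y m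

end Def

/-! ## Components of `G − {u, v}` are two-terminal blocks -/

section Blocks

variable {V : Type*} {E : Type*}

/-- The component of a vertex `y ∉ {u, v}` in `G − {u, v}` is a two-terminal block with terminals
`u, v`. -/
lemma cluster_isBlock (ends : E → Sym2 V) {u v y : V} (hyu : y ≠ u) (hyv : y ≠ v) :
    Block.IsBlock ends (cluster ends (sepConfig ends {u, v}) y) u v := by
  have hy : y ∉ ({u, v} : Set V) := by simp [hyu, hyv]
  refine ⟨fun hu => ?_, fun hv => ?_, fun e he x z hends => ?_⟩
  · exact not_mem_of_conn_sepConfig hy hu (by simp)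
  · exact not_mem_of_conn_sepConfig hy hv (by simp)
  · obtain ⟨hx, hz⟩ := endpoints_mem_of_mem_touches_cluster hy he hends
    simp only [Set.mem_union, Set.mem_insert_iff, Set.mem_singleton_iff] at hx hz
    exact ⟨hx, hz⟩

/-- Inside `G − {u, v}`, a two-terminal block with terminals `u, v` is closed: everything reached
from a vertex of `W` stays in `W`. -/
lemma mem_of_conn_sepConfig_of_isBlock {ends : E → Sym2 V} {W : Set V} {u v : V}
    (hB : Block.IsBlock ends W u v) {x z : V} (hx : x ∈ W)
    (h : Conn ends (sepConfig ends {u, v}) x z) : z ∈ W := by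
  refine mem_of_conn_of_closed' (S := W) ?_ hx h
  intro e x y he hends hxW
  have heW : e ∈ touches ends W := mem_touches_of_ends hends (Or.inl hxW)
  have hnot := not_mem_of_not_mem_touches hends (not_mem_touches_of_sepConfig he)
  rcases (hB.ends_mem e heW x y hends).2 with hyW | rfl | rfl
  · exact hyW
  · exact absurd (by simp : y ∈ ({y, v} : Set V)) hnot.2
  · exact absurd (by simp : y ∈ ({u, y} : Set V)) hnot.2

end Blocks

/-! ## The characterisation -/

section Main

variable {V : Type*} {E : Type*} [Fintype E] [DecidableEq V]

/-- The end of a non-loop edge has positive non-loop degree. -/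
lemma nonLoopDeg_ne_zero_of_ends {ends : E → Sym2 V} {e : E} {x y : V} (hends : ends e = s(x, y))
    (hd : ¬ (ends e).IsDiag) : nonLoopDeg ends x ≠ 0 := by
  intro h0
  unfold nonLoopDeg at h0
  rw [Finset.card_eq_zero] at h0
  have : e ∈ edgesAt ends x := mem_edgesAt.2 ⟨by rw [hends]; exact Sym2.mem_mk_left x y, hd⟩
  rw [h0] at this
  exact Finset.notMem_empty e this

/-- **On the residual, unmarked vertices reach the marks past any two vertices.** -/
theorem marksReach_of_wredT {ends : E → Sym2 V} {o a₁ a₂ a₃ b : V}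
    (h : WReducedT ends o a₁ a₂ a₃ b) : MarksReach ends o a₁ a₂ a₃ b := by
  intro u v y hy hdeg hyu hyv
  by_contra hno
  push Not at hno
  -- the component of `y` in `G − {u, v}` is a mark-free block
  have hB : Block.IsBlock ends (cluster ends (sepConfig ends {u, v}) y) u v :=
    cluster_isBlock ends hyu hyv
  have hfree : ∀ z ∈ cluster ends (sepConfig ends {u, v}) y, Unmarked o a₁ a₂ a₃ b z := by
    intro z hz
    have key : ∀ m, (m = o ∨ m = a₁ ∨ m = a₂ ∨ m = a₃ ∨ m = b) → z ≠ m :=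
      fun m hm hzm => hno m hm (hzm ▸ hz)
    exact ⟨key o (Or.inl rfl), key a₁ (Or.inr (Or.inl rfl)), key a₂ (Or.inr (Or.inr (Or.inl rfl))),
      key a₃ (Or.inr (Or.inr (Or.inr (Or.inl rfl)))), key b (Or.inr (Or.inr (Or.inr (Or.inr rfl))))⟩
  -- `y` has at least two non-loop edges, both touching its component
  have hyW : y ∈ cluster ends (sepConfig ends {u, v}) y := mem_cluster_self ends _ y
  have hdeg' := h.unmarked y hy
  have h2 : 1 < nonLoopDeg ends y := by
    rcases Nat.lt_or_ge 1 (nonLoopDeg ends y) with hlt | hle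
    · exact hlt
    · rcases Nat.le_one_iff_eq_zero_or_eq_one.1 hle with h0 | h1
      · exact absurd h0 hdeg
      · exact absurd h1 hdeg'.1
  obtain ⟨g₁, hg₁, g₂, hg₂, hne⟩ := Finset.one_lt_card.1 h2
  exact h.noBlock ⟨_, u, v, hB, hfree, Or.inl ⟨g₁, g₂, hne, mem_touches_of_mem_edgesAt hyW hg₁,
    mem_touches_of_mem_edgesAt hyW hg₂, (mem_edgesAt.1 hg₁).2, (mem_edgesAt.1 hg₂).2⟩⟩

/-- **The finite check excludes every collapsible block.** -/
theorem not_hasBlock_of_marksReach {ends : E → Sym2 V} {o a₁ a₂ a₃ b : V}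
    (hr : MarksReach ends o a₁ a₂ a₃ b) : ¬ Block.HasBlock ends o a₁ a₂ a₃ b := by
  rintro ⟨W, u, v, hB, hW, hcase⟩
  -- a non-loop edge touching `W`
  obtain ⟨e₀, he₀, hd₀⟩ : ∃ e₀, e₀ ∈ touches ends W ∧ ¬ (ends e₀).IsDiag := by
    rcases hcase with ⟨e₀, _, _, he₀, _, hd₀, _⟩ | ⟨_, e₀, he₀, hd₀⟩
    · exact ⟨e₀, he₀, hd₀⟩
    · exact ⟨e₀, he₀, hd₀⟩
  obtain ⟨y, hyW, z, hends⟩ := he₀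
  have hyu : y ≠ u := fun h => hB.u_notMem (h ▸ hyW)
  have hyv : y ≠ v := fun h => hB.v_notMem (h ▸ hyW)
  obtain ⟨m, hm, hym⟩ := hr u v y (hW y hyW) (nonLoopDeg_ne_zero_of_ends hends hd₀) hyu hyv
  have hmW : m ∈ W := mem_of_conn_sepConfig_of_isBlock hB hyW hym
  have hum := hW m hmW
  rcases hm with rfl | rfl | rfl | rfl | rfl
  · exact hum.1 rfl
  · exact hum.2.1 rfl
  · exact hum.2.2.1 rfl
  · exact hum.2.2.2.1 rfl
  · exact hum.2.2.2.2 rfl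

/-- **The residual with no collapsible block, as a finite check**: `WReducedT ↔ WReducedI ∧
MarksReach`. -/
theorem wredT_iff {ends : E → Sym2 V} {o a₁ a₂ a₃ b : V} :
    WReducedT ends o a₁ a₂ a₃ b ↔ WReducedI ends o a₁ a₂ a₃ b ∧ MarksReach ends o a₁ a₂ a₃ b :=
  ⟨fun h => ⟨h.toWReducedI, marksReach_of_wredT h⟩,
   fun ⟨hI, hr⟩ => ⟨hI, not_hasBlock_of_marksReach hr⟩⟩

/-- **Membership in the residual with no collapsible block is a list of finite checks**: for five
distinct marks, `WReducedT ↔ WReducedW ∧ MarksReach` (g53's cut-vertex-free form of the residual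
plus the reach check). -/
theorem wredT_iff_wredW_and_marksReach {ends : E → Sym2 V} {o a₁ a₂ a₃ b : V} (h12 : a₁ ≠ a₂)
    (h13 : a₁ ≠ a₃) (h23 : a₂ ≠ a₃) (ho1 : o ≠ a₁) (ho2 : o ≠ a₂) (ho3 : o ≠ a₃) (hob : o ≠ b)
    (hb1 : b ≠ a₁) (hb2 : b ≠ a₂) (hb3 : b ≠ a₃) :
    WReducedT ends o a₁ a₂ a₃ b ↔ WReducedW ends o a₁ a₂ a₃ b ∧ MarksReach ends o a₁ a₂ a₃ b := by
  rw [wredT_iff, wredI_iff_wredW h12 h13 h23 ho1 ho2 ho3 hob hb1 hb2 hb3]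

end Main

end WRed

end Summit.Ventures.PercRepro2
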